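import Summits.MatrixMultiplication.MatrixMultiplication.Theorems.AbelianSTPPCensusTargets
import Summits.MatrixMultiplication.OmegaCensus.LocalUSPOmegaBound
import Literature.Computability.AlgebraicComplexity.StrongUSPTriangle
import Literature.Computability.AlgebraicComplexity.GKKSDepthFourProofs

/-!
# Abelian STPP census — explicit upper-end row for T_E (cell mm-stpp, item U-2 of BRACKET-N2-SCOPING.md §3; census-silent)

CENSUS-SILENT BOOKKEEPING, kit 0, no new definitions.  Companion of `AbelianSTPPCensusUpperEnd.lean` (U-1,
existential upper ends).  Here the T_E upper end is made EXPLICIT along the printed strong-USP pipeline of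
Cohn–Kleinberg–Szegedy–Umans 2005, every link of which is a tree theorem:
triangle strong USP of width `3k′` and `s = |Δ_{2^{k′}}| = 2^{k′-1}(2^{k′}+1)` rows
(`CohnKleinbergSzegedyUmans2005_prop18` = `isStrongUSP_cksuTriangleUSP`, CKSU Prop 3.8 / arXiv Prop 18) → local strong USP of `s!` rows and width
`3k′·s` (`IsStrongUSP.exists_isLocalStrongUSP`, Prop 6.3 / 34) → STPP family of `s!` triples in
`Cyc_m^{3k′s}`, each of volume `(m-1)^{3k′s}` (`CohnKleinbergSzegedyUmans2005_thm33_holds`, Thm 6.2 / 33;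
`OmegaCensus.card_usp_triple_mul`).  The census sum `s!·(m-1)^{3k′s·τ/3}` exceeds `|H| = m^{3k′s}` as soon as
`3·m^{3k′} < s·(m-1)^{a}` with `a = 3k′·τ/3` an integer, using the Stirling-free bound `(s/3)^s ≤ s!`
(tree: `GKKS.pow_div_three_le_factorial`).  At `τ = 5/2`, `m = 6`, `k′ = 52`: `a = 130`,
`s = 2^51(2^52+1)` and the single integer comparison `3·6^156 < s·5^130` holds (ratio `1.008`; it FAILS at
`k′ = 50`), giving the explicit host `(ℤ/6)^{156·s}` of order `6^{156·2^51(2^52+1)}` (`|H| ≈ 10^{1.23·10^33}`).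
(`k′ = 49` is the true pipeline minimum but needs `ln Γ` to `4·10⁻⁵` relative — not worth kernel effort,
memo §3.)  The big order is never evaluated: every step is a symbolic rewrite.

WHAT THIS IS / IS NOT (lead plan g22, STATUS 2026-08-29T13:00:39Z / OFFER no. 2): an EXPLICIT UPPER-END row of
the census bracket for tier T_E — the abelian group `(ℤ/6)^{156·2^51(2^52+1)}` carries an STPP family whose
packing sum at `τ = 5/2` exceeds its order.  Census-silent until folded (folding waits for the director's
review ruling, REVIEW-BRIEF-g22 D2); no `ω` statement; not a column; says nothing about any order below
that tower.  HONESTY CLAUSE (lead, STATUS 2026-08-29T13:06:46Z): `K₅₂ = 156·s(52)` is NOT claimed minimal — it is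
the least width at which the `e < 3` shortcut closes with integer exponents (`k′` even for `5k′/2 ∈ ℕ`; `k′ = 50`
fails the integer comparison, ratio `0.94`); the printed pipeline's minimum with exact `s!` is `K₄₉ = 147·s(49)`
(memo §1.2, ratio `1.0028` with `(s/e)^s`) — an explicit UPPER END, not the onset `M*(5/2)`.
`--supports stmt-MatrixMultiplication-19191` helper; kit 0.

References: Cohn–Kleinberg–Szegedy–Umans 2005 (arXiv:math/0511460) Prop 18 (p. 7), Thm 33 and Prop 34 (p. 10);
cell memo `run/shared/lean/pub/mm-stpp/mm-stpp-plan/BRACKET-N2-SCOPING.md` §1.1–§1.2, §3 (U-2).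
-/

set_option linter.dupNamespace false -- `MatrixMultiplication.MatrixMultiplication` (summit = problem, D-0017)
set_option autoImplicit false

noncomputable section

open Finset
open Literature.Computability.AlgebraicComplexity
open Summit.MatrixMultiplication.OmegaCensus

namespace Summit.MatrixMultiplication.MatrixMultiplication.Theorems

/-- **A local strong USP gives an explicit host.** If `row` is a local strong USP of `s` rows and width `k`
and `m^k < s · ((m-1)^k)^{τ/3}` (`m ≥ 1`), then `(ℤ/m)^k` (order `m^k`) hosts an STPP family beating `τ`:
`¬ NoAbelianSTPPHostUpTo τ (m^k)` — CKSU Thm 33 (`uspA/uspB/uspC`, tree-proved) + block volumes `(m-1)^k`.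
Census-silent. [cite: CohnKleinbergSzegedyUmans2005, Thm 33 (p. 10)] -/
theorem not_noAbelianSTPPHostUpTo_pow_of_isLocalStrongUSP {s k : ℕ} {row : Fin s → Fin k → Fin 3}
    (hU : IsLocalStrongUSP row) (m : ℕ) [NeZero m] {τ : ℝ}
    (hbeat : (m : ℝ) ^ k < (s : ℝ) * (((m : ℝ) - 1) ^ k) ^ (τ / 3)) :
    ¬ NoAbelianSTPPHostUpTo τ (m ^ k) := by
  classical
  intro hNo
  have hST := CohnKleinbergSzegedyUmans2005_thm33_holds m k s row hU
  have hcardH : Fintype.card (Fin k → ZMod m) = m ^ k := by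
    rw [Fintype.card_fun, ZMod.card, Fintype.card_fin]
  have h := hNo (Fin k → ZMod m) hcardH.le s (uspA m row) (uspB m row) (uspC m row) hST
  rw [hcardH] at h
  simp_rw [card_usp_triple_mul] at h
  rw [Finset.sum_const, Finset.card_univ, Fintype.card_fin, nsmul_eq_mul] at h
  have h1 : 1 ≤ m := Nat.one_le_iff_ne_zero.mpr (NeZero.ne m)
  have hcast : ((((m - 1) ^ k : ℕ) : ℝ)) = ((m : ℝ) - 1) ^ k := by
    rw [Nat.cast_pow, Nat.cast_sub h1, Nat.cast_one]
  rw [hcast, Nat.cast_pow] at h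
  linarith

/-- **The strong-USP pipeline as an explicit host, general form.** A local strong USP with `s!` rows of width
`s·w` (the Prop-34 blow-up of a strong USP of `s` rows and width `w`), a modulus `m ≥ 1` and an exponent `τ`
with `w·τ/3 = a ∈ ℕ`: if `3·m^w < s·(m-1)^a`, then `(ℤ/m)^{s·w}` hosts an STPP family beating `τ`, i.e.
`¬ NoAbelianSTPPHostUpTo τ (m ^ (w * s))`.  (Census sum `s!·((m-1)^a)^s ≥ (s/3)^s ((m-1)^a)^s > (m^w)^s`.)
Census-silent. [cite: CohnKleinbergSzegedyUmans2005, Thm 33 and Prop 34 (p. 10)] -/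
theorem not_noAbelianSTPPHostUpTo_of_blowup {s w : ℕ} {row : Fin (Nat.factorial s) → Fin (s * w) → Fin 3}
    (hU : IsLocalStrongUSP row) (m : ℕ) [NeZero m] {a : ℕ} {τ : ℝ} (hτ : (w : ℝ) * (τ / 3) = a)
    (hcert : 3 * m ^ w < s * (m - 1) ^ a) :
    ¬ NoAbelianSTPPHostUpTo τ (m ^ (w * s)) := by
  have h1 : 1 ≤ m := Nat.one_le_iff_ne_zero.mpr (NeZero.ne m)
  have hs0 : s ≠ 0 := by
    rintro rfl
    simp at hcert
  have hX0 : (0 : ℝ) ≤ (m : ℝ) - 1 := by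
    have : (1 : ℝ) ≤ (m : ℝ) := by exact_mod_cast h1
    linarith
  -- the integer certificate over `ℝ`: `m^w < (s/3)·(m-1)^a`
  have hc : (3 : ℝ) * (m : ℝ) ^ w < (s : ℝ) * ((m : ℝ) - 1) ^ a := by
    have := hcert
    rw [← Nat.cast_lt (α := ℝ)] at this
    push_cast [Nat.cast_sub h1] at this
    exact this
  have hc' : (m : ℝ) ^ w < (s : ℝ) / 3 * ((m : ℝ) - 1) ^ a := by
    rw [div_mul_eq_mul_div, lt_div_iff₀ (by norm_num : (0 : ℝ) < 3)]
    linarith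
  have key : (m : ℝ) ^ (s * w) < ((Nat.factorial s : ℕ) : ℝ) * (((m : ℝ) - 1) ^ (s * w)) ^ (τ / 3) := by
    -- `((m-1)^{sw})^{τ/3} = ((m-1)^a)^s`
    have hpow : (((m : ℝ) - 1) ^ (s * w)) ^ (τ / 3) = ((((m : ℝ) - 1) ^ a)) ^ s := by
      rw [← Real.rpow_natCast ((m : ℝ) - 1) (s * w), ← Real.rpow_mul hX0]
      have : (((s * w : ℕ)) : ℝ) * (τ / 3) = (((a * s : ℕ)) : ℝ) := by
        push_cast
        rw [mul_assoc, hτ]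
        ring
      rw [this, Real.rpow_natCast, pow_mul]
    rw [hpow, pow_mul']
    -- `(m^w)^s < ((s/3)(m-1)^a)^s ≤ s! ((m-1)^a)^s`
    have hm0 : (0 : ℝ) ≤ (m : ℝ) ^ w := by positivity
    have hlt : ((m : ℝ) ^ w) ^ s < ((s : ℝ) / 3 * ((m : ℝ) - 1) ^ a) ^ s :=
      pow_lt_pow_left₀ hc' hm0 hs0
    have hle : ((s : ℝ) / 3 * ((m : ℝ) - 1) ^ a) ^ s ≤
        ((Nat.factorial s : ℕ) : ℝ) * ((((m : ℝ) - 1) ^ a)) ^ s := by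
      rw [mul_pow]
      exact mul_le_mul_of_nonneg_right (GKKS.pow_div_three_le_factorial s) (pow_nonneg (pow_nonneg hX0 _) _)
    exact lt_of_lt_of_le hlt hle
  have hk : m ^ (w * s) = m ^ (s * w) := by rw [Nat.mul_comm]
  rw [hk]
  exact not_noAbelianSTPPHostUpTo_pow_of_isLocalStrongUSP hU m key

/-- The U-2 integer certificate at `k′ = 52`, `m = 6`, `τ = 5/2` (`a = 130`), with the Prop-18 row count
`|Δ_{2^52}| = 2^52 (2^52+1)/2 = 2^51 (2^52+1)`: `3 · 6^156 < 2^51 (2^52+1) · 5^130` (ratio `1.008`). [bookkeeping] -/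
theorem cert_te_tower_52 : 3 * 6 ^ (3 * 52) < 2 ^ 52 * (2 ^ 52 + 1) / 2 * (6 - 1) ^ 130 := by
  norm_num

/-- **U-2 (tier T_E, explicit):** the abelian group `(ℤ/6)^{156·s}`, `s = 2^51(2^52+1)`, hosts an STPP family
beating `τ = 5/2`: `¬ NoAbelianSTPPHostUpTo (5/2) (6 ^ (156 * (2^51 * (2^52+1))))` — the CKSU strong-USP
pipeline at `k′ = 52` (Prop 18 → Prop 34 → Thm 33, all tree-proved).  Census-silent; no `ω` statement; nothing
about any order below this tower; `K₅₂` is NOT claimed minimal (an explicit upper end, not the onset — see the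
module docstring's honesty clause).  [cite: CohnKleinbergSzegedyUmans2005, Prop 18 (p. 7), Thm 33 and Prop 34 (p. 10)] -/
theorem abelianSTPPHost_beating_250_explicit :
    ¬ NoAbelianSTPPHostUpTo (5 / 2) (6 ^ (156 * (2 ^ 51 * (2 ^ 52 + 1)))) := by
  obtain ⟨row, hrow⟩ := CohnKleinbergSzegedyUmans2005_prop18 52
  obtain ⟨row', hU'⟩ := hrow.exists_isLocalStrongUSP
  have key := not_noAbelianSTPPHostUpTo_of_blowup hU' 6 (a := 130) (τ := 5 / 2)
    (by push_cast; norm_num) cert_te_tower_52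
  have h1 : (3 * 52 : ℕ) = 156 := by norm_num
  have h2 : (2 ^ 52 * (2 ^ 52 + 1) / 2 : ℕ) = 2 ^ 51 * (2 ^ 52 + 1) := by norm_num
  rw [h2, h1] at key
  exact key

end Summit.MatrixMultiplication.MatrixMultiplication.Theorems

end
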